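/-
b2b-lace packet, LEAN TYPING SEAT 2 gen 17 (unit `b2b-lace-lean2-g17`).  (S2b)-IMPR, the ASSEMBLY of [NoBLE17] §3.3.5 carried to the doorstep of the
numeric certificate WITH STEP 1 DISCHARGED: the one displayed analytic input of `NobleWeightedDiagramBound` (p194111) — the Step-1 bound `hStep1`,
[NoBLE17] (3.61)–(3.71) — is now the theorem `NobleH1Step` (tail-g10, p194163) ∘ `NobleH1XSpace` (lit-g18 M2, p193421), packaged table-side by
`NobleH1StepXSpace`; composing leaves ONLY table-side conditions on `τ` and `1 ≤ α̲_F` where `hStep1` stood.  Additive: no existing module is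
modified; d-generic; no numeral; no named fact.
-/
import Literature.Probability.FitznerVanDerHofstad2017.NobleWeightedDiagramBound
import Literature.Probability.FitznerVanDerHofstad2017.NobleH1StepXSpace
import HarnessLib

/-!
# Literature.Probability.FitznerVanDerHofstad2017.NobleWeightedDiagramBoundTables — the weighted-diagram bounds of `f₃` from the extended simplified form and TABLE-SIDE conditions only

CITATION HEADER (PLACEMENT v2). Part of a certified REPRODUCTION of R. Fitzner, R. van der Hofstad, *Generalized approach to the
non-backtracking lace expansion*, Probab. Theory Related Fields 169 (2017) 1041–1119 [NoBLE17], §3.3.5 "Bound on `f₃`" (pp. 1074–1079: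
(3.58)–(3.59) the split `ℋ = Σ_{i=1}^5 ℋ_i`, Step 1 (3.60)–(3.71), Steps 2–5 (3.72)–(3.86), and the conclusion (3.87)), with the companion
*Mean-field behavior for nearest-neighbor percolation in `d > 10`*, Electron. J. Probab. 22 (2017) no. 43 [FvdH17], (2.21)–(2.23) and §2.5:

> [NoBLE17] p. 1079, (3.87): "`f₃(z) ≤ max_{{n,l,S} ∈ 𝒮} sup_{x ∈ S} (Σ_{i=1}^5 BoundH[i](n,l,x)) / c_{n,l,S}`, where the last five `β`'s
> are given in (3.71), (3.75), (3.77), (3.78) and (3.86) respectively."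
> [NoBLE17] p. 1076, (3.71): the bound on `∫ Ĥ₁ Ĝⁿ D̂^l D̂^{(x)}` "in terms of the SRW-integrals `I_{n,l}`, `𝒥_{n,l}`, `T_{n,l}`".

Every `[cite:]` tag below is a LOCATOR for comparison, not an appeal to authority: all statements are proved here from tree theorems.
`hd` thresholds are integrability bookkeeping of the formalisation (always met at `d = 11`).  DIVERGENCE D80 (packet): the printed Step-1 slot
bounds (3.61)/(3.62) hold only at `α_F = 1`; the tree's Step-1 leaf (`NobleH1Step`) proves `|∫ Ĥ₁ …| ≤ F3Bounds.boundH1 τ n l x r` (the cell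
UNCHANGED) from the corrected two-sided x-space slot bounds (`NobleH1XSpace`) under `1 ≤ α̲_F` and the DISPLAYED table-side conditions (H-IM),
(H-SC), (H-LOW), (H-IM1), (H-low1) on `τ.IM` — which therefore appear below, by name, exactly where `hStep1` stood (the D33/D79 pattern, REFEREE
v73/v75 ORDERS (4)); nothing is decided here about the numerals (no numeral of any certificate revision comes from D80).

## What this module does ((S2b)-IMPR-ASM ∘ L3, HOME/LEMMAS)

1. `NobleF3Witness.step1_of_tables` — for `d ≥ 9`, `1 ≤ α̲_F = r.afmin` and a table `τ` with (H-IM)/(H-SC)/(H-LOW) at `m ≤ 1`, (H-IM1)/(H-low1)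
   and (H-T) `srwTS ≤ τ.T`: the Step-1 bound `|∫ Ĥ₁ Ĝⁿ D̂^l D̂^{(x)} dk/(2π)^d| ≤ F3Bounds.boundH1 τ n l x r` holds at `n = 0, 1`, every `(l, x)`, for
   EVERY admissible witness `NobleF3Witness d p B E r cΦ αΦ cF αF RΦ RF` — i.e. literally the binder `hStep1` of
   `nobleWeightedDiagramBoundAt_of_witness` (the witness supplies `KeyBounds r` off `{D̂ = 1}` and the strict window `c_F + α_F + R̂_F(0) < 1`;
   `NobleH1StepXSpace.abs_integral_H1_diagram_le_boundH1_zero_of_tables` / `_one_of_tables` do the rest).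
2. `nobleWeightedDiagramBoundAt_of_witness_tables`, `nobleWeightedDiagramBoundAt_of_simplifiedFormF3_tables` — §4 of `NobleWeightedDiagramBound`
   with `hStep1` replaced by those table-side conditions.
3. `nobleImprovementInputsAt_of_simplifiedFormF3_tables` — §5 of `NobleWeightedDiagramBound` likewise: the improvement-step input
   `NobleImprovementInputsAt d cμ c Γ B b` of the numeric certificate (`NobleInstantiate`) from the extended simplified form on `(p_I, p_c) ∩ {f ≤ Γ}`,
   `1 ≤ α̲_F`, `β̲_{ΔR,F} < α̲_F`, well-formed `r = NobleBetaF3.toArgs d B E Γ₂` with (H-Γ) at `n = 0, 1`, a table `τ` with `K = srwK`, `U = srwU`,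
   (H-T), (H-IM), (H-SC), (H-LOW), (H-IM1), (H-low1), and the six numeric cell inequalities `boundHD75 τ n_k l_k x r ≤ b_k`, `b_k ≥ 0`.

What remains displayed after this module: NO analytic input of §3.3.5 — only the extended simplified form itself (`hF3`; delivered from [NoBLE17]
Assumption 4.3 / the NoBLE equation by the App.-D line `NobleAppDKeyBounds`, p194275), the table identities/inequalities (`K = srwK`, `U = srwU`,
(H-T), (H-IM), (H-SC), (H-LOW), (H-IM1), (H-low1): SRW-side, certified-numerics territory — num3 `MeanFieldD11Stage1TabsTUQ` for T/U, the engines'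
IM / SC tables for IM), `r.WF`, (H-Γ), `1 ≤ α̲_F`, `β̲_{ΔR,F} < α̲_F`, and the six cell inequalities (the certificate's literals via
`F3BoundsTablesMonoAt.boundHD75_mono_at`).

Heartbeat census (packet filing rule, REFEREE v73 ORDERS (2)): all four declarations are short term-mode compositions / an `interval_cases` on
`n ≤ 1`; nothing approaches 100 000; no option set.
-/

noncomputable section

open MeasureTheory Real
open Literature.Barriers.CriticalPhenomena
open Literature.Barriers.CriticalPhenomena.Slade2006Prop53 (P)
open Literature.Probability.LatticeModels
open Literature.Probability.Percolation

namespace Literature.Probability.FitznerVanDerHofstad2017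

variable {d : ℕ}

/-! ## 1. Step 1 for every admissible witness, from the table side -/

/-- **[NoBLE17] §3.3.5 Step 1 ((3.60)–(3.71)) for every admissible witness of the extended simplified form, `n = 0, 1`, from TABLE-SIDE conditions.**
For `d ≥ 9`, `1 ≤ α̲_F` and a table `τ` satisfying (H-IM) `𝒥_{m+2,j}(y) ≤ IM[m,j,y]`, (H-SC) `I_{m+3,j}(y) ≤ d·α̲_F·IM[m,j,y]`, (H-LOW)
`(ᾱ_F − 1)·S_{m+3,j}(y) ≤ 2d²·IM[m,j,y]` for `m ≤ 1`, (H-IM1) `I_{1,j+1}(y) + S_{2,j}(y)/(2d²α̲_F) ≤ IM[−1,j,y]`, (H-low1) `I_{2,j}(y) ≤ d·α̲_F·IM[−1,j,y]`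
and (H-T) `TS_{m,j}(y) ≤ τ.T m j y`: every witness `NobleF3Witness d p B E r cΦ αΦ cF αF RΦ RF` satisfies
`|∫ Ĥ₁ Ĝⁿ D̂^l D̂^{(x)} dP/(2π)^d| ≤ F3Bounds.boundH1 τ n l x r` for `n ≤ 1` and all `l, x` — the binder `hStep1` of
`nobleWeightedDiagramBoundAt_of_witness`, discharged (`NobleH1StepXSpace` with the witness's `KeyBounds` and strict window).
[cite: FitznerVanDerHofstad2016NoBLE, §3.3.5 (3.58)–(3.71) pp. 1074–1076] [cite: FitznerVanDerHofstad2017, notebook General.nb In[2] BoundH[1]] -/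
theorem NobleF3Witness.step1_of_tables (hd : 9 ≤ d) {p : unitInterval} {B : NobleBeta} {E : NobleBetaF3} {r : F3Bounds.Args}
    (hα1 : 1 ≤ r.afmin) (τ : F3Bounds.Tables (Fin d → ℤ))
    (hIM : ∀ (m j : ℕ) (y : Fin d → ℤ), m ≤ 1 → srwJ d (m + 2) j y ≤ τ.IM m j y)
    (hSC : ∀ (m j : ℕ) (y : Fin d → ℤ), m ≤ 1 → srwI d (m + 3) j y ≤ d * r.afmin * τ.IM m j y)
    (hLow : ∀ (m j : ℕ) (y : Fin d → ℤ), m ≤ 1 → (r.afmax - 1) * srwIShift2 d (m + 3) j y ≤ 2 * (d : ℝ) ^ 2 * τ.IM m j y)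
    (hIM1 : ∀ (j : ℕ) (y : Fin d → ℤ), srwI d 1 (j + 1) y + srwIShift2 d 2 j y / (2 * (d : ℝ) ^ 2 * r.afmin) ≤ τ.IM (-1) j y)
    (hLow1 : ∀ (j : ℕ) (y : Fin d → ℤ), srwI d 2 j y ≤ d * r.afmin * τ.IM (-1) j y)
    (hT : ∀ (m j : ℕ) (y : Fin d → ℤ), srwTS d r.afmin m j y ≤ τ.T m j y) :
    ∀ n ≤ 1, ∀ (l : ℕ) (x : Site d), ∀ ⦃cΦ αΦ cF αF : ℝ⦄ ⦃RΦ RF : Site d → ℝ⦄,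
      NobleF3Witness d p B E r cΦ αΦ cF αF RΦ RF →
      |(∫ k, (lapAtomsAt d cΦ αΦ cF αF RΦ RF k).H1 * (lapAtomsAt d cΦ αΦ cF αF RΦ RF k).G ^ n *
        Dhat d k ^ l * DhatSym d x k ∂P d) / (2 * π) ^ d| ≤ F3Bounds.boundH1 τ n l x r := by
  intro n hn l x cΦ αΦ cF αF RΦ RF w
  interval_cases n
  · exact abs_integral_H1_diagram_le_boundH1_zero_of_tables (by omega) w.keyBounds w.fZero_lt_one hα1 τ
      (fun j y => by simpa using hIM 0 j y (Nat.zero_le 1)) (fun j y => by simpa using hSC 0 j y (Nat.zero_le 1))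
      (fun j y => by simpa using hLow 0 j y (Nat.zero_le 1)) hIM1 hLow1 l x
  · exact abs_integral_H1_diagram_le_boundH1_one_of_tables (by omega) w.keyBounds w.fZero_lt_one hα1 τ hIM hSC hLow hT l x

/-! ## 2. The six cells of `f₃`, table side only -/

/-- **(S2b)-IMPR with Step 1 discharged: the weighted-diagram bounds of `f₃` from an admissible witness and the table side.**  For `d ≥ 9`, `p < p_c`,
an admissible witness at well-formed `r` with (H-Γ) at `n = 0, 1` and `1 ≤ α̲_F`, a table `τ` with `K = srwK`, `U = srwU`, (H-T), (H-IM), (H-SC),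
(H-LOW), (H-IM1), (H-low1), and the six cell inequalities `boundHD75 τ n_k l_k x r ≤ b_k` (`b_k ≥ 0`): `NobleWeightedDiagramBoundAt d p b`.
[cite: FitznerVanDerHofstad2016NoBLE, §3.3.5 (3.87) p. 1079 with (3.58)–(3.86) pp. 1074–1079] [cite: FitznerVanDerHofstad2017, (2.21)–(2.23), §2.5] -/
theorem nobleWeightedDiagramBoundAt_of_witness_tables (hd : 9 ≤ d) {p : unitInterval}
    (hp : (p : ℝ) < criticalProb (zdGraph d) (0 : Site d)) {B : NobleBeta} {E : NobleBetaF3} {r : F3Bounds.Args}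
    (hW : ∃ (cΦ αΦ cF αF : ℝ) (RΦ RF : Site d → ℝ), NobleF3Witness d p B E r cΦ αΦ cF αF RΦ RF)
    (hr : r.WF) (hΓ : ∀ n ≤ 1, r.Gamma2dash ^ n * r.bRp ≤ r.bRpDelta) (hα1 : 1 ≤ r.afmin)
    (τ : F3Bounds.Tables (Fin d → ℤ)) (hK : ∀ m l x, τ.K m l x = srwK d m l x) (hU : ∀ m l x, τ.U m l x = srwU d m l x)
    (hT : ∀ (m j : ℕ) (y : Fin d → ℤ), srwTS d r.afmin m j y ≤ τ.T m j y)
    (hIM : ∀ (m j : ℕ) (y : Fin d → ℤ), m ≤ 1 → srwJ d (m + 2) j y ≤ τ.IM m j y)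
    (hSC : ∀ (m j : ℕ) (y : Fin d → ℤ), m ≤ 1 → srwI d (m + 3) j y ≤ d * r.afmin * τ.IM m j y)
    (hLow : ∀ (m j : ℕ) (y : Fin d → ℤ), m ≤ 1 → (r.afmax - 1) * srwIShift2 d (m + 3) j y ≤ 2 * (d : ℝ) ^ 2 * τ.IM m j y)
    (hIM1 : ∀ (j : ℕ) (y : Fin d → ℤ), srwI d 1 (j + 1) y + srwIShift2 d 2 j y / (2 * (d : ℝ) ^ 2 * r.afmin) ≤ τ.IM (-1) j y)
    (hLow1 : ∀ (j : ℕ) (y : Fin d → ℤ), srwI d 2 j y ≤ d * r.afmin * τ.IM (-1) j y)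
    {b : Fin 6 → ℝ} (hb : ∀ k, 0 ≤ b k)
    (h0 : ∀ x ∈ calX d, F3Bounds.boundHD75 τ 0 0 x r ≤ b 0) (h1 : ∀ x ∈ calX d, F3Bounds.boundHD75 τ 1 0 x r ≤ b 1)
    (h2 : ∀ x ∈ calX d, F3Bounds.boundHD75 τ 1 1 x r ≤ b 2) (h3 : ∀ x ∈ calX d, F3Bounds.boundHD75 τ 1 2 x r ≤ b 3)
    (h4 : ∀ x ∈ calX d, F3Bounds.boundHD75 τ 1 3 x r ≤ b 4) (h5 : F3Bounds.boundHD75 τ 1 6 0 r ≤ b 5) :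
    NobleWeightedDiagramBoundAt d p b :=
  nobleWeightedDiagramBoundAt_of_witness hd hp hW hr hΓ τ hK hU hT
    (NobleF3Witness.step1_of_tables hd hα1 τ hIM hSC hLow hIM1 hLow1 hT) hb h0 h1 h2 h3 h4 h5

/-- **The same from the extended simplified form** `NobleSimplifiedFormF3At d p B E` below `p_c` under `f₂(p) ≤ Γ₂`, at the arguments
`r = NobleBetaF3.toArgs d B E Γ₂` (`1 ≤ α̲_F = B.αFlow`, `β̲_{ΔR,F} < α̲_F`), table side only.
[cite: FitznerVanDerHofstad2016NoBLE, §3.3.5 (3.87) p. 1079; §3.3.4 pp. 1072–1074] [cite: FitznerVanDerHofstad2017, (2.21)–(2.23), §2.5] -/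
theorem nobleWeightedDiagramBoundAt_of_simplifiedFormF3_tables (hd : 9 ≤ d) {p : unitInterval}
    (hp : (p : ℝ) < criticalProb (zdGraph d) (0 : Site d)) {B : NobleBeta} {E : NobleBetaF3} {Γ₂ : ℝ}
    (hF3 : NobleSimplifiedFormF3At d p B E) (hΓ2 : nobleF2 d p ≤ Γ₂) (hα1 : 1 ≤ B.αFlow) (hgap : B.βΔ < B.αFlow)
    (hr : (NobleBetaF3.toArgs d B E Γ₂).WF)
    (hΓ : ∀ n ≤ 1, (NobleBetaF3.toArgs d B E Γ₂).Gamma2dash ^ n * (NobleBetaF3.toArgs d B E Γ₂).bRp ≤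
      (NobleBetaF3.toArgs d B E Γ₂).bRpDelta)
    (τ : F3Bounds.Tables (Fin d → ℤ)) (hK : ∀ m l x, τ.K m l x = srwK d m l x) (hU : ∀ m l x, τ.U m l x = srwU d m l x)
    (hT : ∀ (m j : ℕ) (y : Fin d → ℤ), srwTS d B.αFlow m j y ≤ τ.T m j y)
    (hIM : ∀ (m j : ℕ) (y : Fin d → ℤ), m ≤ 1 → srwJ d (m + 2) j y ≤ τ.IM m j y)
    (hSC : ∀ (m j : ℕ) (y : Fin d → ℤ), m ≤ 1 → srwI d (m + 3) j y ≤ d * B.αFlow * τ.IM m j y)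
    (hLow : ∀ (m j : ℕ) (y : Fin d → ℤ), m ≤ 1 → (E.αFup - 1) * srwIShift2 d (m + 3) j y ≤ 2 * (d : ℝ) ^ 2 * τ.IM m j y)
    (hIM1 : ∀ (j : ℕ) (y : Fin d → ℤ), srwI d 1 (j + 1) y + srwIShift2 d 2 j y / (2 * (d : ℝ) ^ 2 * B.αFlow) ≤ τ.IM (-1) j y)
    (hLow1 : ∀ (j : ℕ) (y : Fin d → ℤ), srwI d 2 j y ≤ d * B.αFlow * τ.IM (-1) j y)
    {b : Fin 6 → ℝ} (hb : ∀ k, 0 ≤ b k)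
    (h0 : ∀ x ∈ calX d, F3Bounds.boundHD75 τ 0 0 x (NobleBetaF3.toArgs d B E Γ₂) ≤ b 0)
    (h1 : ∀ x ∈ calX d, F3Bounds.boundHD75 τ 1 0 x (NobleBetaF3.toArgs d B E Γ₂) ≤ b 1)
    (h2 : ∀ x ∈ calX d, F3Bounds.boundHD75 τ 1 1 x (NobleBetaF3.toArgs d B E Γ₂) ≤ b 2)
    (h3 : ∀ x ∈ calX d, F3Bounds.boundHD75 τ 1 2 x (NobleBetaF3.toArgs d B E Γ₂) ≤ b 3)
    (h4 : ∀ x ∈ calX d, F3Bounds.boundHD75 τ 1 3 x (NobleBetaF3.toArgs d B E Γ₂) ≤ b 4)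
    (h5 : F3Bounds.boundHD75 τ 1 6 0 (NobleBetaF3.toArgs d B E Γ₂) ≤ b 5) :
    NobleWeightedDiagramBoundAt d p b :=
  nobleWeightedDiagramBoundAt_of_witness_tables hd hp (hF3.exists_witness (by omega) hp hΓ2 (lt_of_lt_of_le one_pos hα1) hgap) hr hΓ hα1
    τ hK hU hT hIM hSC hLow hIM1 hLow1 hb h0 h1 h2 h3 h4 h5

/-! ## 3. Packaging as the improvement-step input `NobleImprovementInputsAt`, table side only -/

/-- **The improvement-step input of the numeric certificate from the extended simplified form, the TABLE SIDE and the six cells — no analytic input of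
§3.3.5 left displayed.**  For `d ≥ 9`: if at every `p ∈ (p_I, p_c)` with `f_i(p) ≤ Γ_i` the two-point function has the extended simplified form
`NobleSimplifiedFormF3At d p B E`, `1 ≤ α̲_F = B.αFlow`, `β_Δ < α̲_F`, the arguments `r = NobleBetaF3.toArgs d B E (Γ 1)` are well formed with (H-Γ) at
`n = 0, 1`, the table `τ` has `K = srwK`, `U = srwU` and satisfies (H-T), (H-IM), (H-SC), (H-LOW), (H-IM1), (H-low1), and the six cell inequalities
`boundHD75 τ n_k l_k x r ≤ b_k` hold with `b_k ≥ 0`, then `NobleImprovementInputsAt d cμ c Γ B b`.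
[cite: FitznerVanDerHofstad2016NoBLE, §3.3.5 (3.87) p. 1079 with Steps 1–5; Assumption 2.7 and Prop. 4.5 (pp. 1059–1060, 1088)]
[cite: FitznerVanDerHofstad2017, Prop. 2.1–2.2, (2.21)–(2.23), §2.5] -/
theorem nobleImprovementInputsAt_of_simplifiedFormF3_tables (hd : 9 ≤ d) {cμ : ℝ} {c : Fin 6 → ℝ} {Γ : Fin 3 → ℝ}
    {B : NobleBeta} {E : NobleBetaF3}
    (hF3 : ∀ p : unitInterval, p ∈ Set.Ioo (nbwThresholdI d) (criticalProbI d) →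
      (∀ i, nobleF d cμ c i p ≤ Γ i) → NobleSimplifiedFormF3At d p B E)
    (hα1 : 1 ≤ B.αFlow) (hgap : B.βΔ < B.αFlow) (hr : (NobleBetaF3.toArgs d B E (Γ 1)).WF)
    (hΓ : ∀ n ≤ 1, (NobleBetaF3.toArgs d B E (Γ 1)).Gamma2dash ^ n * (NobleBetaF3.toArgs d B E (Γ 1)).bRp ≤
      (NobleBetaF3.toArgs d B E (Γ 1)).bRpDelta)
    (τ : F3Bounds.Tables (Fin d → ℤ)) (hK : ∀ m l x, τ.K m l x = srwK d m l x) (hU : ∀ m l x, τ.U m l x = srwU d m l x)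
    (hT : ∀ (m j : ℕ) (y : Fin d → ℤ), srwTS d B.αFlow m j y ≤ τ.T m j y)
    (hIM : ∀ (m j : ℕ) (y : Fin d → ℤ), m ≤ 1 → srwJ d (m + 2) j y ≤ τ.IM m j y)
    (hSC : ∀ (m j : ℕ) (y : Fin d → ℤ), m ≤ 1 → srwI d (m + 3) j y ≤ d * B.αFlow * τ.IM m j y)
    (hLow : ∀ (m j : ℕ) (y : Fin d → ℤ), m ≤ 1 → (E.αFup - 1) * srwIShift2 d (m + 3) j y ≤ 2 * (d : ℝ) ^ 2 * τ.IM m j y)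
    (hIM1 : ∀ (j : ℕ) (y : Fin d → ℤ), srwI d 1 (j + 1) y + srwIShift2 d 2 j y / (2 * (d : ℝ) ^ 2 * B.αFlow) ≤ τ.IM (-1) j y)
    (hLow1 : ∀ (j : ℕ) (y : Fin d → ℤ), srwI d 2 j y ≤ d * B.αFlow * τ.IM (-1) j y)
    {b : Fin 6 → ℝ} (hb : ∀ k, 0 ≤ b k)
    (h0 : ∀ x ∈ calX d, F3Bounds.boundHD75 τ 0 0 x (NobleBetaF3.toArgs d B E (Γ 1)) ≤ b 0)
    (h1 : ∀ x ∈ calX d, F3Bounds.boundHD75 τ 1 0 x (NobleBetaF3.toArgs d B E (Γ 1)) ≤ b 1)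
    (h2 : ∀ x ∈ calX d, F3Bounds.boundHD75 τ 1 1 x (NobleBetaF3.toArgs d B E (Γ 1)) ≤ b 2)
    (h3 : ∀ x ∈ calX d, F3Bounds.boundHD75 τ 1 2 x (NobleBetaF3.toArgs d B E (Γ 1)) ≤ b 3)
    (h4 : ∀ x ∈ calX d, F3Bounds.boundHD75 τ 1 3 x (NobleBetaF3.toArgs d B E (Γ 1)) ≤ b 4)
    (h5 : F3Bounds.boundHD75 τ 1 6 0 (NobleBetaF3.toArgs d B E (Γ 1)) ≤ b 5) :
    NobleImprovementInputsAt d cμ c Γ B b :=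
  nobleImprovementInputsAt_of_simplifiedFormF3 hd hF3 (lt_of_lt_of_le one_pos hα1) hgap hr hΓ τ hK hU hT
    (fun _ _ _ => NobleF3Witness.step1_of_tables hd hα1 τ hIM hSC hLow hIM1 hLow1 hT) hb h0 h1 h2 h3 h4 h5

end Literature.Probability.FitznerVanDerHofstad2017

end
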